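import Summits.CriticalPhenomena.PercolationContinuityZ3.Theorems.PercNearOneGluingNoHeavyQuantFarBlockLocalityHair
import Summits.CriticalPhenomena.PercolationContinuityZ3.Theorems.PercNearOneGluingNoHeavyQuantFarBlockLocalityStem
import HarnessLib

/-!
# QUANT lane R8, front "FAR beyond trees", layer one — **BLOCK-LOCALITY AT LAYER ONE, THE THEOREM**: FAR(1) for a pendant block in EVERY
# environment follows from FAR(1) in its environments with at most two edges

builds on p205010 (kernel theorem, internal audit signed; external expert review pending)

Support file (`--supports stmt-CriticalPhenomena-4575`), seat `prim-quant-p1` (gen 24); memo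
`run/shared/lean/prim/quant/prim-quant-p1-g24/FOR-LEAD-INTRINSIC.md` §2, §5, §6.  Standard axioms; no sorries; no definitions.

THE THEOREM (`Block.layerOne_of_twoEdgeFAR`).  `w` any weight function on the pairs of `Fin n`; `Z` hangs at the cut vertex `c` (`o, c ∉ Z`,
`w` vanishes between `Z` and `(Z ∪ {c})ᶜ`); `A ∩ Z` contains two relays `a₀ ≠ a₁`, `a₀` of least internal marginal.
HYPOTHESIS `hFAR` ("the block in its TWO-EDGE ENVIRONMENTS satisfies FAR(1)"): for every weight function `w'` agreeing with `w` on the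
pairs meeting `Z` and having at most two non-loop pairs of positive weight off `Z` (`∀ e ∈ avoid Z, ¬e.IsDiag → w' e ≠ 0 → e = e₁ ∨ e = e₂`),
every observer `o'`, relay set `A'` and threshold `t'`: `2 < Σ_{A'} P_{w'}(o' ↔ a)` and `P_{w'}(o' ↮ a) ≤ t'` on `A'` imply
`P_{w'}(#{a ∈ A' : o' ↔ a} ≤ 1) ≤ t'`.  (Such `w'` are the block plus a forest on two extra vertices; for a TREE block they are trees and
`farRelayRow_tree_layerOne` discharges `hFAR` — that instantiation, with the tree bookkeeping, is `…QuantFarPendantTree*`.)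
CONCLUSION: the layer-one far-relay row holds for `w` at `o`: `2 < Σ_{a∈A} P(o ↔ a)` and `P(o ↮ a) ≤ t` on `A` imply
`P_w(#{a ∈ A : o ↔ a} ≤ 1) ≤ t`.  Nothing is assumed about `w` outside `Z` beyond the hanging condition.
WHY THIS IS BLOCK-LOCALITY.  p1 g19–g22 transferred pendant blocks by an environment-AGNOSTIC comparison (domination), refuted for junction cores by
p1 g23.  The correct statement is this one: a block's worth at layer one is decided by the simplest environments (a stem and a hair), because the
linear programme over the environment coefficients `(A₀, B, C)` under Harris, the outside first-moment count and `EN > 2` at the observer is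
extremised there (`…QuantFarBlockIntrinsicSharp*`).  Instantiation for TREE blocks (where the two-edge environments are trees and
`farRelayRow_tree_layerOne` applies): `Block.layerOne_of_pendantTree` (`…QuantFarPendantTree`): every graph with a pendant subtree carrying two
relays satisfies FAR at layer one.  The same instantiation is available to any class closed under 'two more edges at the cut vertex side'
on which FAR(1) is known (cacti: `Block.layerOne_of_cactus`).
* `Block.layerOne_of_twoEdgeFAR_spare` — with the two spare vertices `u ≠ b ∉ Z ∪ {c}` explicit;
* `Block.layerOne_of_twoEdgeFAR` — in general (with fewer than two vertices off `Z ∪ {c}` the actual environment is itself a two-edge environment).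
[cite: Grimmett1999, §1.3 p. 10; §2.2] (product measure); [cite: KozmaNitzan2024, Conjecture 3 (p. 15)] (FAR is the `j = 1` far-relay row);
the theorems [this work].
-/

noncomputable section

namespace Summit.CriticalPhenomena.PercolationContinuityZ3.Theorems

namespace Quant

namespace Block

open Finset MeasureTheory Set
open Literature.Probability.LatticeModels
open Literature.Probability.Percolation
open Bundle (offZ avoid offZ_subset real_offZ_event_eq_of_agree)
open scoped Classical

variable {n : ℕ} {o c : Fin n} {Z : Finset (Fin n)}

/-- **BLOCK-LOCALITY AT LAYER ONE (two spare vertices given).**  `w` hangs a block on `Z` at `c` (`o, c ∉ Z`); `A ∩ Z` contains `a₀ ≠ a₁`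
with `a₀` of least internal marginal; `u ≠ b` lie off `Z ∪ {c}`.  HYPOTHESIS `hFAR` (the block in its TWO-EDGE environments): the layer-one
FAR instance holds for every weight function `w'` that agrees with `w` on the pairs meeting `Z` and has at most two non-loop pairs of positive
weight off `Z`, for every observer, relay set and threshold.  CONCLUSION: the layer-one FAR instance holds for `w` itself at `o` — i.e. in
the ACTUAL environment, whatever it is.  PROOF: `hFAR` on the three auxiliary weight functions 'block alone', 'block + hair `s(c,b)`',
'block + stem `s(u,c)` + hair `s(u,b)`' gives `t_S ≥ τ₀` when `M_in > 2` (exit lemma) and (B2♯) when `M_in ≤ 2`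
(`oneHair_ineq_of_twoEdgeFAR`, `stemHair_ineq_of_twoEdgeFAR`, `sharp_light_of_oneHair`, `sharp_medium_of_stemHair`), then
`real_card_le_one_le_sharp₂`. [this work] -/
theorem layerOne_of_twoEdgeFAR_spare (w : Sym2 (Fin n) → unitInterval) (ho : o ∉ Z) (hc : c ∉ Z)
    (hw : ∀ x y : Fin n, x ≠ y → x ∈ Z → y ∉ Z → y ≠ c → (w s(x, y) : ℝ) = 0)
    (hFAR : ∀ (w' : Sym2 (Fin n) → unitInterval) (e₁ e₂ : Sym2 (Fin n)) (o' : Fin n) (A' : Finset (Fin n)) (t' : ℝ),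
      (∀ e, e ∉ avoid Z → w e = w' e) →
      (∀ e ∈ avoid Z, ¬ e.IsDiag → w' e ≠ 0 → e = e₁ ∨ e = e₂) →
      (2 : ℝ) < ∑ a ∈ A', (prodBernoulli w').real (openConn o' a) →
      (∀ a ∈ A', (prodBernoulli w').real (openConn o' a : Set (BondConfig (Fin n)))ᶜ ≤ t') →
      (prodBernoulli w').real {ω : BondConfig (Fin n) | (A'.filter fun a => ω ∈ openConn o' a).card ≤ 1} ≤ t')
    {u b : Fin n} (huZ : u ∉ Z) (huc : u ≠ c) (hbZ : b ∉ Z) (hbc : b ≠ c) (hub : u ≠ b)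
    (A : Finset (Fin n)) (t : ℝ) {a₀ a₁ : Fin n} (ha₀ : a₀ ∈ A ∩ Z) (ha₁ : a₁ ∈ A ∩ Z) (hne : a₀ ≠ a₁)
    (hmin : ∀ a ∈ A ∩ Z, (prodBernoulli w).real {ω | onZ Z ω ∈ openConn c a₀} ≤ (prodBernoulli w).real {ω | onZ Z ω ∈ openConn c a})
    (hEN : (2 : ℝ) < ∑ a ∈ A, (prodBernoulli w).real (openConn o a))
    (hcut : ∀ a ∈ A, (prodBernoulli w).real (openConn o a)ᶜ ≤ t) :
    (prodBernoulli w).real {ω : BondConfig (Fin n) | (A.filter fun a => ω ∈ openConn o a).card ≤ 1} ≤ t := by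
  set μ := prodBernoulli w with hμ
  set τ₀ := μ.real {ω | onZ Z ω ∈ openConn c a₀} with hτ₀
  set M := ∑ a ∈ A ∩ Z, μ.real {ω | onZ Z ω ∈ openConn c a} with hMdef
  set hS := μ.real {ω | 1 ≤ ((A ∩ Z).filter fun a => onZ Z ω ∈ openConn c a).card} with hhS
  set tS := μ.real {ω | 2 ≤ ((A ∩ Z).filter fun a => onZ Z ω ∈ openConn c a).card} with htS
  by_cases hM : M ≤ 2
  · have hτh : τ₀ ≤ hS := by
      refine measureReal_mono (fun ω hω => ?_) (measure_ne_top _ _)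
      simp only [mem_setOf_eq] at hω ⊢
      exact Finset.card_pos.2 ⟨a₀, Finset.mem_filter.2 ⟨ha₀, hω⟩⟩
    have htShS : tS ≤ hS := by
      refine measureReal_mono (fun ω hω => ?_) (measure_ne_top _ _)
      simp only [mem_setOf_eq] at hω ⊢; omega
    have hτ0 : 0 ≤ τ₀ := measureReal_nonneg
    have hτ1 : τ₀ ≤ 1 := measureReal_le_one
    have hB2l : M + τ₀ ≤ 2 → τ₀ - tS ≤ (hS - tS) * (2 - M) := by
      intro hl
      refine sharp_light_of_oneHair (by linarith) (by linarith) hl fun p hp hp1 => ?_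
      have hp0 : 0 ≤ p := by linarith
      have := oneHair_ineq_of_twoEdgeFAR w hc hw hFAR hbZ hbc A hmin hp0 hp1 (by linarith)
      linarith
    have hB2m : 2 < M + τ₀ → (τ₀ - tS) * (M + τ₀) ≤ 2 * (hS - tS) * τ₀ := by
      intro hm
      have := sharp_medium_of_stemHair (s := hS - tS) (t := tS) (by linarith) hτ0 hτ1 hm fun g p hg0 hg1 hp0 hp1 hE => by
        have := stemHair_ineq_of_twoEdgeFAR w hc hw hFAR huZ huc hbZ hbc hub A hmin hg0 hg1 hp0 hp1 (by linarith)
        linarith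
      linarith
    exact real_card_le_one_le_sharp₂ w ho hc hw A t ha₀ ha₁ hne (hmin a₁ ha₁) hcut hEN hM hB2l hB2m
  · have hM' : 2 < M := lt_of_not_ge hM
    have hexit := blockAlone_ineq_of_twoEdgeFAR w hc hw hFAR A hmin hM'
    exact real_card_le_one_le_of_exit w ho hc hw A t ha₀ (hcut a₀ (Finset.mem_inter.1 ha₀).1) hexit

/-- **BLOCK-LOCALITY AT LAYER ONE.**  As `layerOne_of_twoEdgeFAR_spare` without the spare vertices: if fewer than two vertices lie off
`Z ∪ {c}`, the actual environment IS a two-edge environment (its only possible non-loop pair off `Z` is `s(c, v)` for the one outside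
vertex `v`) and `hFAR` applies to `w` itself.  So: **FAR at layer one for a pendant block in EVERY environment follows from FAR at layer one
in its environments with at most two edges** (all of them forests on two extra vertices: 'stem + hair', 'hair', nothing). [this work] -/
theorem layerOne_of_twoEdgeFAR (w : Sym2 (Fin n) → unitInterval) (ho : o ∉ Z) (hc : c ∉ Z)
    (hw : ∀ x y : Fin n, x ≠ y → x ∈ Z → y ∉ Z → y ≠ c → (w s(x, y) : ℝ) = 0)
    (hFAR : ∀ (w' : Sym2 (Fin n) → unitInterval) (e₁ e₂ : Sym2 (Fin n)) (o' : Fin n) (A' : Finset (Fin n)) (t' : ℝ),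
      (∀ e, e ∉ avoid Z → w e = w' e) →
      (∀ e ∈ avoid Z, ¬ e.IsDiag → w' e ≠ 0 → e = e₁ ∨ e = e₂) →
      (2 : ℝ) < ∑ a ∈ A', (prodBernoulli w').real (openConn o' a) →
      (∀ a ∈ A', (prodBernoulli w').real (openConn o' a : Set (BondConfig (Fin n)))ᶜ ≤ t') →
      (prodBernoulli w').real {ω : BondConfig (Fin n) | (A'.filter fun a => ω ∈ openConn o' a).card ≤ 1} ≤ t')
    (A : Finset (Fin n)) (t : ℝ) {a₀ a₁ : Fin n} (ha₀ : a₀ ∈ A ∩ Z) (ha₁ : a₁ ∈ A ∩ Z) (hne : a₀ ≠ a₁)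
    (hmin : ∀ a ∈ A ∩ Z, (prodBernoulli w).real {ω | onZ Z ω ∈ openConn c a₀} ≤ (prodBernoulli w).real {ω | onZ Z ω ∈ openConn c a})
    (hEN : (2 : ℝ) < ∑ a ∈ A, (prodBernoulli w).real (openConn o a))
    (hcut : ∀ a ∈ A, (prodBernoulli w).real (openConn o a)ᶜ ≤ t) :
    (prodBernoulli w).real {ω : BondConfig (Fin n) | (A.filter fun a => ω ∈ openConn o a).card ≤ 1} ≤ t := by
  by_cases hsp : ∃ u b : Fin n, u ∉ Z ∧ u ≠ c ∧ b ∉ Z ∧ b ≠ c ∧ u ≠ b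
  · obtain ⟨u, b, huZ, huc, hbZ, hbc, hub⟩ := hsp
    exact layerOne_of_twoEdgeFAR_spare w ho hc hw hFAR huZ huc hbZ hbc hub A t ha₀ ha₁ hne hmin hEN hcut
  · have hone : ∀ x y : Fin n, x ∉ Z → x ≠ c → y ∉ Z → y ≠ c → x = y := by
      intro x y hx hxc hy hyc
      by_contra hxy
      exact hsp ⟨x, y, hx, hxc, hy, hyc, hxy⟩
    have hmem_avoid : ∀ x y : Fin n, s(x, y) ∈ avoid Z ↔ x ∉ Z ∧ y ∉ Z := by
      intro x y
      rw [Bundle.avoid, Finset.mem_filter]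
      constructor
      · intro h; exact ⟨fun hx => h.2 x hx (Sym2.mem_mk_left _ _), fun hy => h.2 y hy (Sym2.mem_mk_right _ _)⟩
      · rintro ⟨hx, hy⟩
        refine ⟨Finset.mem_univ _, fun z hz hzm => ?_⟩
        rcases Sym2.mem_iff.1 hzm with rfl | rfl
        · exact hx hz
        · exact hy hz
    -- the one possible non-loop pair off `Z`
    set e₁ : Sym2 (Fin n) := if h : ∃ v : Fin n, v ∉ Z ∧ v ≠ c then s(c, Classical.choose h) else s(c, c) with he₁
    have htwo : ∀ e ∈ avoid Z, ¬ e.IsDiag → w e ≠ 0 → e = e₁ ∨ e = e₁ := by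
      intro e he hnd _
      left
      induction e using Sym2.ind with
      | h x y =>
        obtain ⟨hx, hy⟩ := (hmem_avoid x y).1 he
        have hxy : x ≠ y := fun h => hnd (Sym2.mk_isDiag_iff.2 h)
        -- one of `x, y` is `c`, the other is the outside vertex
        have hv : ∃ v : Fin n, v ∉ Z ∧ v ≠ c := by
          by_cases hxc : x = c
          · exact ⟨y, hy, fun h => hxy (hxc.trans h.symm)⟩
          · exact ⟨x, hx, hxc⟩
        have hspec := Classical.choose_spec hv
        rw [he₁, dif_pos hv]
        by_cases hxc : x = c
        · have hyc : y ≠ c := fun h => hxy (hxc.trans h.symm)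
          rw [hxc, hone y (Classical.choose hv) hy hyc hspec.1 hspec.2]
        · have hxv : x = Classical.choose hv := hone x _ hx hxc hspec.1 hspec.2
          by_cases hyc : y = c
          · rw [hyc, hxv, Sym2.eq_swap]
          · exact absurd ((hone x y hx hxc hy hyc)) hxy
    exact hFAR w e₁ e₁ o A t (fun _ _ => rfl) htwo hEN hcut

end Block
end Quant
end Summit.CriticalPhenomena.PercolationContinuityZ3.Theorems
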